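import Literature.MathematicalPhysics.KineticTheory.TaggedSphereSpectralGap

/-!
# Dictionary step for the crux `InformationPercolationEngine.SpectralContractionR`
# (stmt-AtomisticToContinuum-13913), line `Sketch`, stub `stub_gainOpRep`

The Riesz-defined gain operator `T = gainOp` on BGSR's Hilbert space `L²(a₁ M₁)` acts pointwise
as `a₁⁻¹ K⁺` (Carleman form): for `f` of finite energy, a representative of `T (toLp f)` is
`v ↦ a₁(v)⁻¹ ∫ k₁(v, u) f(v + u) du` for a.e. `v`. Proof: test against indicators `1_S ∈ L²`
(the template is `ae_sub_carlemanGain_eq_of` of `TaggedSphereDiffusionCorrector`).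
-/

noncomputable section
open MeasureTheory Metric Real Set Filter Topology
open scoped InnerProductSpace ENNReal
namespace Summit.AtomisticToContinuum.HydrodynamicLimit.Theorems.SpectralContractionRLine.GainOpRep
open Literature.MathematicalPhysics.KineticTheory
open Literature.Analysis.FunctionSpaces (maxwellianBeta maxwellianBeta_one maxwellianBeta_pos)
open TaggedSphereDiffusion (collisionFrequency)

/-- `2 ≤ 3`: the dimension hypothesis of the tagged-sphere library at `d = Fin 3`. [folklore] -/
theorem hd3 : 2 ≤ Fintype.card (Fin 3) := by simp

/-- **Dictionary**: the Riesz-defined gain operator `T = gainOp` on `L²(a₁ M₁)` acts pointwise as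
`a₁⁻¹ K⁺`: for `f` of finite energy, `rep (T (toLp f)) = a₁⁻¹ · carlemanGain 1 f` a.e.
(test `⟪T (toLp f), 1_S⟫` against indicators: it is both `∫_S rep (T (toLp f)) a₁ M₁` and
`carlemanForm 1 f 1_S = ∫_S (K⁺ f) M₁`; the integrable density `(a₁ rep (T G) - K⁺ f) M₁` has all
set integrals zero, hence vanishes a.e., and `a₁ M₁ > 0`). [folklore] -/
theorem stub_gainOpRep : ∀ (f : V3 → ℝ) (hf : FiniteEnergy 1 f),
    rep (gainOp hd3 one_pos ((hf.memLp one_pos).toLp f)) =ᵐ[volume]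
      fun v => (collisionFrequency 1 v)⁻¹ * carlemanGain 1 f v := by
  intro f hf
  set G : Lp ℝ 2 (energyMeasure (d := Fin 3) 1) := (hf.memLp one_pos).toLp f with hGdef
  have hrepG : rep G =ᵐ[volume] f := rep_toLp_ae_eq hd3 one_pos (hf.memLp one_pos)
  have hg : FiniteEnergy 1 (rep (gainOp hd3 one_pos G)) := finiteEnergy_rep one_pos _
  set Ψ : V3 → ℝ := fun v =>
    (collisionFrequency 1 v * rep (gainOp hd3 one_pos G) v - carlemanGain 1 f v) *
      maxwellianBeta 1 v with hΨ
  have h1 := integrable_collisionFrequency_mul_mul_maxwellianBeta one_pos hg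
  have h2 := integrable_carlemanGain_mul_maxwellianBeta hd3 one_pos hf
  have hΨint : Integrable Ψ :=
    (h1.sub h2).congr (Eventually.of_forall fun v => by simp only [hΨ, Pi.sub_apply]; ring)
  -- `∫_S Ψ = 0` for every measurable `S`
  have hzero : ∀ S : Set V3, MeasurableSet S → volume S < ∞ → ∫ v in S, Ψ v = 0 := by
    intro S hS _
    have hmem := memLp_indicator_energyMeasure (d := Fin 3) (β := (1 : ℝ)) one_pos hS
    set hS' : Lp ℝ 2 (energyMeasure (d := Fin 3) 1) := hmem.toLp _ with hhS
    have hrep : rep hS' =ᵐ[volume] S.indicator fun _ => (1 : ℝ) := rep_toLp_ae_eq hd3 one_pos hmem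
    have hind := finiteEnergy_indicator (d := Fin 3) (β := (1 : ℝ)) one_pos hS
    have hbd : ∀ᵐ v ∂(volume : Measure V3), ‖S.indicator (fun _ => (1 : ℝ)) v‖ ≤ 1 :=
      Eventually.of_forall fun v => by by_cases hv : v ∈ S <;> simp [hv]
    have hmi : AEStronglyMeasurable (S.indicator fun _ => (1 : ℝ)) (volume : Measure V3) :=
      (measurable_const.indicator hS).aestronglyMeasurable
    -- the inner product `⟪T G, 1_S⟫`, read in two ways
    have e1 : ⟪gainOp hd3 one_pos G, hS'⟫_ℝ = ∫ v, S.indicator (fun _ => (1 : ℝ)) v *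
        (collisionFrequency 1 v * rep (gainOp hd3 one_pos G) v * maxwellianBeta 1 v) := by
      rw [inner_eq_integral_rep one_pos]
      refine integral_congr_ae ?_
      filter_upwards [hrep] with v hv
      rw [hv]; ring
    have e2 : ⟪gainOp hd3 one_pos G, hS'⟫_ℝ = ∫ v, S.indicator (fun _ => (1 : ℝ)) v *
        (carlemanGain 1 f v * maxwellianBeta 1 v) := by
      rw [inner_gainOp, ← truncForm_one, truncForm_congr_ae 1 _ hrepG hrep, truncForm_one,
        carlemanForm_eq_integral_carlemanGain hd3 one_pos hf.measurable hf.integrable hind.measurable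
          hind.integrable]
      refine integral_congr_ae (Eventually.of_forall fun v => ?_)
      ring
    have i1 := h1.bdd_mul (c := 1) hmi hbd
    have i2 := h2.bdd_mul (c := 1) hmi hbd
    rw [← integral_indicator hS]
    have hΨS : S.indicator Ψ = fun v =>
        S.indicator (fun _ => (1 : ℝ)) v *
            (collisionFrequency 1 v * rep (gainOp hd3 one_pos G) v * maxwellianBeta 1 v) -
          S.indicator (fun _ => (1 : ℝ)) v * (carlemanGain 1 f v * maxwellianBeta 1 v) := by
      funext v
      by_cases hv : v ∈ S
      · simp only [indicator_of_mem hv, hΨ, one_mul]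
        ring
      · simp only [indicator_of_notMem hv, zero_mul, sub_zero]
    simp only [hΨS]
    rw [integral_sub i1 i2, ← e1, ← e2, sub_self]
  have hae := hΨint.ae_eq_zero_of_forall_setIntegral_eq_zero hzero
  filter_upwards [hae] with v hv
  simp only [hΨ, Pi.zero_apply, mul_eq_zero] at hv
  have haM := collisionFrequency_mul_maxwellianBeta_pos hd3 one_pos v
  rcases hv with hv | hv
  · have ha : collisionFrequency 1 v ≠ 0 := left_ne_zero_of_mul haM.ne'
    rw [eq_inv_mul_iff_mul_eq₀ ha]
    linarith
  · exact absurd hv (maxwellianBeta_pos one_pos v).ne'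

end Summit.AtomisticToContinuum.HydrodynamicLimit.Theorems.SpectralContractionRLine.GainOpRep

end
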